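import Mathlib
import Summits.BirchSwinnertonDyer.BirchSwinnertonDyer.Theorems.ResidualThetaTransportAtTwoResidualSignedLambdaLowerCMAtTwoColemanSidePush
import HarnessLib

/-!
# stub-ideation k3 · gen 19 — DECOMPOSITION of the (i)-half PRICE node of S3″ (`e`, `he` for k2-g18's adapter):
# H10 is not a stub (it is H9 + LATTICE + the landed `X`-adic separation run over `A := 𝒪`), and H9 is ONE pairing identity behind a
# kernel-proved Schur transport. Sub-stubs typed, every glue PROVED.

Crux (R≥)ᵖ `ResidualThetaCountLowerPureAtTwo` (stmt-BirchSwinnertonDyer-26074), stub `stub_cmLambdaLower` of `Lines/bt26_lambda.lean` v7 =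
RSL_g (stmt-BirchSwinnertonDyer-22608) VERBATIM; skeleton of record on 22608 = `Lines/onepair.lean` v3d. Nothing here re-types, weakens or
splits a registered stub; BSD is NOT proved by any of this; RSL_g and (R≥)ᵖ stay OPEN. No `instance`, no `sorry`, no new notation.

DICTIONARY (RTT): `R := ℤ_[2]`, `𝒪 := padicCoeffIntegers S`, `ι := padicIntToCoeffIntegers S`, `Λ := PowerSeries ℤ_[2]`,
`Λ_𝒪 := IwasawaAlgebraO S = PowerSeries 𝒪`, `H := I.H`, `𝒸 := π.cvec : I.H → (Fin n → Λ)`, `S := Submodule.span Λ_𝒪 {z}`,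
`T := ↥(W.geomPrimaryTorsion 2)` with `G := absoluteGaloisGroup (π.v.adicCompletion ℚ)` acting through `resGalOfEmb`, `M := Cofree ρ ↥(padicCoeffField S)`,
`Θ := Θ π.v π.hv : M ≃+ (Fin n → T)` (RSL_g binder, `hΘ` = its `G`-equivariance).

§1 SCHUR ⟹ MATRIX (generic, PROVED): a `G`-equivariant additive endomorphism of `Tⁿ` is an `R`-matrix when `End_G(T) = R` (`exists_matrix_of_equivariant`);
   the transport of an `𝒪`-action through an equivariant `Θ : M ≃+ Tⁿ` is a RING HOM `A : 𝒪 →+* Mₙ(R)` with `Θ (a • m) i = ∑ j, A a i j • Θ m j`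
   (`exists_ringHom_of_equivariant`) — the 2-adic form of the landed residual `ThetaTransport.exists_matrix_theta_comp`.
§2 THE TRIVIALISATION `e` (generic, PROVED): from an additive `Φ : 𝒪 ≃+ Rⁿ`, `triv Φ : (Fin n → Λ) ≃+ Λ_𝒪` coefficientwise; it is `Λ`-semilinear
   (`triv_smul`), and carries the coefficientwise matrix action of `A a` to multiplication by `C a` when `Φ (a * b) = (A a).mulVec (Φ b)` (`triv_matrixSMul`).
§3 H10 FROM ITS PARTS (generic, PROVED): LIN-X on `S` + LIN-𝒪 on `S` (H9's VALUE form) + LATTICE `Φ` ⟹ `e (𝒸 (s • x)) = s * e (𝒸 x)` for EVERY `s ∈ Λ_𝒪`,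
   by the landed `ColemanSideInjective.apply_smul_eq_smul_of_X_of_C` run with `A := 𝒪`, `V := Λ_𝒪` (`semilinear_on_submodule`, `exists_trivialisation`).
§4 GLUE to k2-g18 PLAN 1 (PROVED): H10-on-`Λ_𝒪 z` + H11 ⟹ `he : ∀ r, e (𝒸 (r • z)) = r * (D * (Lm * u))` (`he_of_parts`).
§5 LATTICE (generic, PROVED): `Rⁿ` with a ring hom `A : 𝒪 →+* Mₙ(R)`, `𝒪` a PID free of rank `n` over `R`, torsion-free action ⟹ `∃ Φ : 𝒪 ≃+ Rⁿ`
   equivariant (`exists_equivariant_addEquiv`) — H10 (a): "a faithful `𝒪`-lattice of `R`-rank `[𝒪 : R]` is free of rank one"; `htf_of_norm`: torsion-freeness is automatic.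
§6 the rank bookkeeping `n = f` from `2`-torsion cardinalities (generic, PROVED): `n_eq_of_card_torsionBy`.

References: [Washington1997] §13.2, §7.1; [Lang1990] Ch. 5 §1; [Kato2004Asterisque] Thm. 12.5 (1) (p. 221), §13.8 (p. 228); [Kobayashi2003] Thm. 6.2;
[Serre1972] Prop. 12; [PerrinRiou1994Invent] §3.6.1.
-/

set_option autoImplicit false
-- the Cruxes namespace of this sub repeats the summit name by design (D-0017 nested layout)
set_option linter.dupNamespace false

noncomputable section

open scoped BigOperators

namespace Summit.BirchSwinnertonDyer.BirchSwinnertonDyer.Cruxes.ResidualThetaCountLowerPureAtTwo.SideaK3G19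

/-! ## §1 SCHUR ⟹ MATRIX: equivariant endomorphisms of `Tⁿ`, and the ring hom `A : 𝒪 →+* Mₙ(R)` transported through `Θ` -/

section SchurMatrix

variable {R : Type*} [CommRing R] {T : Type*} [AddCommGroup T] [Module R T]
  {G : Type*} [Monoid G] [DistribMulAction G T]

/-- `∑ j, A i j • ∑ l, B j l • w l = ∑ l, (A * B) i l • w l` (module-valued `mulVec_mulVec`). [cite: Lang1990, Ch. 5 §1] -/
theorem sum_smul_sum_smul {n : ℕ} (A B : Matrix (Fin n) (Fin n) R) (w : Fin n → T) (i : Fin n) :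
    ∑ j, A i j • ∑ l, B j l • w l = ∑ l, (A * B) i l • w l := by
  simp_rw [Finset.smul_sum, ← mul_smul, Matrix.mul_apply, Finset.sum_smul]
  rw [Finset.sum_comm]

/-- **Schur ⟹ matrix.** If every `G`-equivariant additive endomorphism of `T` is an `R`-scalar, then every `G`-equivariant additive endomorphism of `Tⁿ`
(diagonal action) is an `R`-matrix: `F w i = ∑ j, A i j • w j`. [cite: Serre1972, Prop. 12] [cite: Lang1990, Ch. 5 §1] -/
theorem exists_matrix_of_equivariant {n : ℕ} (D : Set G)
    (hSchur : ∀ f : T →+ T, (∀ g ∈ D, ∀ t : T, f (g • t) = g • f t) → ∃ c : R, ∀ t, f t = c • t)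
    (F : (Fin n → T) →+ (Fin n → T)) (hF : ∀ g ∈ D, ∀ w : Fin n → T, F (g • w) = g • F w) :
    ∃ A : Matrix (Fin n) (Fin n) R, ∀ w i, F w i = ∑ j, A i j • w j := by
  classical
  have key : ∀ i j : Fin n, ∃ c : R, ∀ t : T, F (Pi.single j t) i = c • t := by
    intro i j
    refine hSchur ((Pi.evalAddMonoidHom (fun _ : Fin n => T) i).comp (F.comp (AddMonoidHom.single (fun _ : Fin n => T) j))) ?_
    intro g hg t
    show F (Pi.single j (g • t)) i = g • F (Pi.single j t) i
    rw [Pi.single_smul, hF g hg, Pi.smul_apply]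
  choose A hA using key
  refine ⟨Matrix.of A, fun w i => ?_⟩
  conv_lhs => rw [← Finset.univ_sum_single w]
  rw [map_sum, Finset.sum_apply]
  exact Finset.sum_congr rfl fun j _ => by rw [Matrix.of_apply, hA]

/-- Uniqueness of the matrix when `T` is a FAITHFUL `R`-module. [cite: Lang1990, Ch. 5 §1] -/
theorem matrix_eq_of_faithful (hfaith : ∀ c : R, (∀ t : T, c • t = 0) → c = 0) {n : ℕ} (A B : Matrix (Fin n) (Fin n) R)
    (h : ∀ (w : Fin n → T) (i : Fin n), ∑ j, A i j • w j = ∑ j, B i j • w j) : A = B := by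
  classical
  ext i j
  rw [← sub_eq_zero]
  refine hfaith _ fun t => ?_
  have h1 := h (Pi.single j t) i
  simp only [Pi.single_apply, smul_ite, smul_zero, Finset.sum_ite_eq', Finset.mem_univ, if_true] at h1
  rw [sub_smul, h1, sub_self]

variable {𝒪 : Type*} [Ring 𝒪] {M : Type*} [AddCommGroup M] [Module 𝒪 M] [DistribMulAction G M]

/-- The conjugate `Θ ∘ (a • ·) ∘ Θ⁻¹` of the `𝒪`-action, as an additive endomorphism of `Tⁿ`. [cite: Kato2004Asterisque, §13.8 (p. 228)] -/
def conjAct {n : ℕ} (Θ : M ≃+ (Fin n → T)) (a : 𝒪) : (Fin n → T) →+ (Fin n → T) :=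
  Θ.toAddMonoidHom.comp ((DistribSMul.toAddMonoidHom M a).comp Θ.symm.toAddMonoidHom)

omit [Module R T] in
theorem conjAct_apply {n : ℕ} (Θ : M ≃+ (Fin n → T)) (a : 𝒪) (w : Fin n → T) : conjAct Θ a w = Θ (a • Θ.symm w) := rfl

omit [Module R T] in
/-- `Θ⁻¹` is equivariant when `Θ` is. [cite: Kato2004Asterisque, §13.8 (p. 228)] -/
theorem symm_smul {n : ℕ} (Θ : M ≃+ (Fin n → T)) (g : G) (hΘ : ∀ m : M, Θ (g • m) = g • Θ m) (w : Fin n → T) :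
    Θ.symm (g • w) = g • Θ.symm w :=
  Θ.injective (by rw [hΘ, AddEquiv.apply_symm_apply, AddEquiv.apply_symm_apply])

/-- **Schur ⟹ ring hom (H9's algebraic core, PROVED).** For an equivariant additive `Θ : M ≃+ Tⁿ`, an `𝒪`-module structure on `M` commuting with `G`,
`End_G(T) = R` and `T` faithful over `R`: the transported action is a ring hom `A : 𝒪 →+* Mₙ(R)` with `Θ (a • m) i = ∑ j, A a i j • Θ m j`.
[cite: Serre1972, Prop. 12] [cite: Kato2004Asterisque, §13.8 (p. 228)] -/
theorem exists_ringHom_of_equivariant {n : ℕ} (D : Set G)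
    (hSchur : ∀ f : T →+ T, (∀ g ∈ D, ∀ t : T, f (g • t) = g • f t) → ∃ c : R, ∀ t, f t = c • t)
    (hfaith : ∀ c : R, (∀ t : T, c • t = 0) → c = 0)
    (Θ : M ≃+ (Fin n → T)) (hΘ : ∀ g ∈ D, ∀ m : M, Θ (g • m) = g • Θ m)
    (hcomm : ∀ g ∈ D, ∀ (a : 𝒪) (m : M), g • (a • m) = a • (g • m)) :
    ∃ A : 𝒪 →+* Matrix (Fin n) (Fin n) R, ∀ (a : 𝒪) (m : M) (i : Fin n), Θ (a • m) i = ∑ j, A a i j • Θ m j := by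
  classical
  have hequiv : ∀ a : 𝒪, ∀ g ∈ D, ∀ w : Fin n → T, conjAct Θ a (g • w) = g • conjAct Θ a w := by
    intro a g hg w
    rw [conjAct_apply, conjAct_apply, symm_smul Θ g (hΘ g hg), ← hcomm g hg, hΘ g hg]
  choose A₀ hA₀ using fun a : 𝒪 => exists_matrix_of_equivariant (R := R) D hSchur (conjAct Θ a) (hequiv a)
  -- `hA₀ a : ∀ w i, conjAct Θ a w i = ∑ j, A₀ a i j • w j`
  have hact : ∀ (a : 𝒪) (m : M) (i : Fin n), Θ (a • m) i = ∑ j, A₀ a i j • Θ m j := by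
    intro a m i
    rw [← hA₀ a (Θ m) i, conjAct_apply, AddEquiv.symm_apply_apply]
  refine ⟨{ toFun := A₀, map_one' := ?_, map_mul' := ?_, map_zero' := ?_, map_add' := ?_ }, hact⟩
  · refine matrix_eq_of_faithful hfaith _ _ fun w i => ?_
    rw [← hA₀ 1 w i, conjAct_apply, one_smul, AddEquiv.apply_symm_apply]
    simp only [Matrix.one_apply, ite_smul, one_smul, zero_smul, Finset.sum_ite_eq, Finset.mem_univ, if_true]
  · intro a b
    refine matrix_eq_of_faithful hfaith _ _ fun w i => ?_
    rw [← hA₀ (a * b) w i, conjAct_apply, mul_smul, ← sum_smul_sum_smul]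
    rw [hact a, Finset.sum_congr rfl fun j _ => by rw [hact b]]
    simp only [AddEquiv.apply_symm_apply]
  · refine matrix_eq_of_faithful hfaith _ _ fun w i => ?_
    rw [← hA₀ 0 w i, conjAct_apply, zero_smul, map_zero, Pi.zero_apply]
    simp only [Matrix.zero_apply, zero_smul, Finset.sum_const_zero]
  · intro a b
    refine matrix_eq_of_faithful hfaith _ _ fun w i => ?_
    rw [← hA₀ (a + b) w i, conjAct_apply, add_smul, map_add, Pi.add_apply, hact a, hact b]
    simp only [AddEquiv.apply_symm_apply, Matrix.add_apply, add_smul, Finset.sum_add_distrib]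

end SchurMatrix

/-! ## §1b (REMOVED — IN TREE). The `2`-adic Schur input of H9 (`End_{D_v}(W[2^m]) = ℤ/2^m`, dévissage from the residual Schur) is LANDED:
`ThetaTransport.decomp_equivariant_addMonoidHom_primary_eq_nsmul` / `…_pi_primary_eq_sum_nsmul` (`…ThetaTransportIntegralSchurAtTwo.lean`, w3 g0),
under `serre1972_supersingular_decompositionSubgroup_image_holds`. A generic dévissage lemma proved here in draft was deleted to cite the tree instead. -/


/-! ## §2 THE TRIVIALISATION `e = triv Φ : (Fin n → R⟦X⟧) ≃+ 𝒪⟦X⟧`, coefficientwise from `Φ : 𝒪 ≃+ Rⁿ` -/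

section Triv

variable {R : Type*} [CommRing R] {𝒪 : Type*} [CommRing 𝒪] {n : ℕ}

/-- **The trivialisation (H10 (b)).** Coefficientwise transport along an additive `Φ : 𝒪 ≃+ Rⁿ`:
`(triv Φ t)_m = Φ⁻¹ ((t i)_m)_i`. [cite: Washington1997, §7.1] -/
def triv (Φ : 𝒪 ≃+ (Fin n → R)) : (Fin n → PowerSeries R) ≃+ PowerSeries 𝒪 where
  toFun t := PowerSeries.mk fun m => Φ.symm fun i => PowerSeries.coeff m (t i)
  invFun s := fun i => PowerSeries.mk fun m => Φ (PowerSeries.coeff m s) i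
  left_inv t := by
    funext i
    ext m
    simp only [PowerSeries.coeff_mk, AddEquiv.apply_symm_apply]
  right_inv s := by
    ext m
    simp only [PowerSeries.coeff_mk, AddEquiv.symm_apply_apply]
  map_add' t t' := by
    ext m
    simp only [PowerSeries.coeff_mk, Pi.add_apply, map_add]
    rw [← map_add]
    rfl

theorem coeff_triv (Φ : 𝒪 ≃+ (Fin n → R)) (t : Fin n → PowerSeries R) (m : ℕ) :
    PowerSeries.coeff m (triv Φ t) = Φ.symm fun i => PowerSeries.coeff m (t i) := by
  simp only [triv, AddEquiv.coe_mk, Equiv.coe_fn_mk, PowerSeries.coeff_mk]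

/-- `Φ⁻¹ (c • v) = ι c * Φ⁻¹ v` from `Φ (ι c * b) = c • Φ b`. [cite: Washington1997, §7.1] -/
theorem symm_smul_eq (ι : R →+* 𝒪) (Φ : 𝒪 ≃+ (Fin n → R)) (hΦι : ∀ (c : R) (b : 𝒪), Φ (ι c * b) = c • Φ b)
    (c : R) (v : Fin n → R) : Φ.symm (c • v) = ι c * Φ.symm v :=
  Φ.injective (by rw [hΦι, AddEquiv.apply_symm_apply, AddEquiv.apply_symm_apply])

/-- **`triv Φ` is `Λ`-semilinear (PROVED)**: `e (r • t) = (map ι r) * e t` for every `r ∈ R⟦X⟧` — the instance-free form of `R⟦X⟧`-linearity w.r.t.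
`(PowerSeries.map ι).toAlgebra` (T64: no global algebra instance; the seam does `letI`). [cite: Washington1997, §7.1, §13.2] -/
theorem triv_smul (ι : R →+* 𝒪) (Φ : 𝒪 ≃+ (Fin n → R)) (hΦι : ∀ (c : R) (b : 𝒪), Φ (ι c * b) = c • Φ b)
    (r : PowerSeries R) (t : Fin n → PowerSeries R) :
    triv Φ (r • t) = PowerSeries.map ι r * triv Φ t := by
  ext m
  rw [coeff_triv, PowerSeries.coeff_mul]
  have hcoeff : (fun i => PowerSeries.coeff m ((r • t) i)) =
      ∑ q ∈ Finset.HasAntidiagonal.antidiagonal m, PowerSeries.coeff q.1 r • fun i => PowerSeries.coeff q.2 (t i) := by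
    funext i
    rw [Pi.smul_apply, smul_eq_mul, PowerSeries.coeff_mul, Finset.sum_apply]
    exact Finset.sum_congr rfl fun q _ => by rw [Pi.smul_apply, smul_eq_mul]
  rw [hcoeff, map_sum]
  exact Finset.sum_congr rfl fun q _ => by rw [symm_smul_eq ι Φ hΦι, PowerSeries.coeff_map, coeff_triv]

/-- LIN-X at the target: `e (X • t) = X * e t` (no hypothesis on `Φ`). [cite: Washington1997, §13.2] -/
theorem triv_X_smul (Φ : 𝒪 ≃+ (Fin n → R)) (t : Fin n → PowerSeries R) :
    triv Φ ((PowerSeries.X : PowerSeries R) • t) = (PowerSeries.X : PowerSeries 𝒪) * triv Φ t := by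
  ext m
  rw [coeff_triv]
  cases m with
  | zero =>
      simp only [Pi.smul_apply, smul_eq_mul, PowerSeries.coeff_zero_X_mul]
      exact map_zero Φ.symm
  | succ m =>
      simp only [Pi.smul_apply, smul_eq_mul, PowerSeries.coeff_succ_X_mul, coeff_triv]

/-- The coefficientwise action of a constant matrix `N ∈ Mₙ(R)` on `(R⟦X⟧)ⁿ`: `(N ⋆ t) i = ∑ j, C (N i j) * t j` (written inline below).
**`triv Φ` carries it to multiplication by `C a` when `Φ (a * b) = (A a).mulVec (Φ b)` (PROVED)** — H9's VALUE form meets H10. [cite: Kato2004Asterisque, §13.8 (p. 228)] -/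
theorem triv_matrixSMul (Φ : 𝒪 ≃+ (Fin n → R)) (A : 𝒪 →+* Matrix (Fin n) (Fin n) R)
    (hΦA : ∀ a b : 𝒪, Φ (a * b) = (A a).mulVec (Φ b)) (a : 𝒪) (t : Fin n → PowerSeries R) :
    triv Φ (fun i => ∑ j, (PowerSeries.C (A a i j) : PowerSeries R) * t j) = (PowerSeries.C a : PowerSeries 𝒪) * triv Φ t := by
  ext m
  rw [coeff_triv, PowerSeries.coeff_C_mul, coeff_triv]
  have hsymm : ∀ v : Fin n → R, Φ.symm ((A a).mulVec v) = a * Φ.symm v := fun v =>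
    Φ.injective (by rw [hΦA, AddEquiv.apply_symm_apply, AddEquiv.apply_symm_apply])
  rw [← hsymm]
  congr 1
  funext i
  rw [map_sum, Matrix.mulVec, dotProduct]
  exact Finset.sum_congr rfl fun j _ => by rw [PowerSeries.coeff_C_mul]

end Triv

/-! ## §3 H10 FROM ITS PARTS: LIN-X + LIN-𝒪 on a `Λ_𝒪`-submodule + LATTICE ⟹ full `Λ_𝒪`-semilinearity of `e ∘ 𝒸` there -/

section Semilinear

variable {R : Type*} [CommRing R] {𝒪 : Type*} [CommRing 𝒪] {n : ℕ}
  {H : Type*} [AddCommGroup H] [Module (PowerSeries 𝒪) H]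

/-- `𝒪⟦X⟧` is `X`-adically separated. [cite: Lang1990, Ch. 5 §1 (p. 94)] -/
theorem powerSeries_eq_zero_of_forall_X_pow (v : PowerSeries 𝒪)
    (h : ∀ N : ℕ, ∃ w : PowerSeries 𝒪, v = (PowerSeries.X : PowerSeries 𝒪) ^ N • w) : v = 0 := by
  ext m
  obtain ⟨w, hw⟩ := h (m + 1)
  rw [hw, smul_eq_mul, PowerSeries.coeff_X_pow_mul', if_neg (by omega), map_zero]

/-- **H10 on a submodule from LIN-X, LIN-𝒪 and the lattice (PROVED).** If on the `Λ_𝒪`-submodule `S` the coordinates satisfy the single `X`-step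
(landed at RTT: `ThetaTransport.colTuple_locd₂_X_smul`) and the `𝒪`-CONSTANT step through the matrices `A a` (H9's value form), and `Φ` is an
`A`-equivariant additive trivialisation `𝒪 ≃+ Rⁿ` (§5), then `triv Φ (𝒸 (s • x)) = s * triv Φ (𝒸 x)` for EVERY `s ∈ 𝒪⟦X⟧`, `x ∈ S`: the landed
finite-to-full lemma `ColemanSideInjective.apply_smul_eq_smul_of_X_of_C` run with constants `A := 𝒪` (not `ℤ₂`) and `V := 𝒪⟦X⟧`.
[cite: Washington1997, §13.2] [cite: Lang1990, Ch. 6 §2 (p. 111)] -/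
theorem semilinear_on_submodule (𝒸 : H →+ (Fin n → PowerSeries R)) (S : Submodule (PowerSeries 𝒪) H)
    (A : 𝒪 →+* Matrix (Fin n) (Fin n) R) (Φ : 𝒪 ≃+ (Fin n → R)) (hΦA : ∀ a b : 𝒪, Φ (a * b) = (A a).mulVec (Φ b))
    (hX : ∀ x ∈ S, 𝒸 ((PowerSeries.X : PowerSeries 𝒪) • x) = (PowerSeries.X : PowerSeries R) • 𝒸 x)
    (hO : ∀ (a : 𝒪), ∀ x ∈ S, 𝒸 ((PowerSeries.C a : PowerSeries 𝒪) • x) = fun i => ∑ j, (PowerSeries.C (A a i j) : PowerSeries R) * 𝒸 x j)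
    (s : PowerSeries 𝒪) : ∀ x ∈ S, triv Φ (𝒸 (s • x)) = s * triv Φ (𝒸 x) := by
  intro x hx
  have key := Theorems.ColemanSideInjective.apply_smul_eq_smul_of_X_of_C (A := 𝒪) (ΛO := PowerSeries 𝒪) (V := PowerSeries 𝒪)
    powerSeries_eq_zero_of_forall_X_pow (RingHom.id (PowerSeries 𝒪)) ((triv Φ).toAddMonoidHom.comp 𝒸) S
    (fun y hy => by
      rw [RingHom.id_apply, AddMonoidHom.comp_apply, AddMonoidHom.comp_apply, AddEquiv.coe_toAddMonoidHom, hX y hy, triv_X_smul,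
        smul_eq_mul])
    (fun a y hy => by
      rw [RingHom.id_apply, AddMonoidHom.comp_apply, AddMonoidHom.comp_apply, AddEquiv.coe_toAddMonoidHom, hO a y hy,
        triv_matrixSMul Φ A hΦA, smul_eq_mul])
    s x hx
  simpa only [RingHom.id_apply, AddMonoidHom.comp_apply, AddEquiv.coe_toAddMonoidHom, smul_eq_mul] using key

/-- **H10 = ∃ e (PROVED from the sub-stubs).** The `Λ`-semilinear trivialisation with `e (𝒸 (s • x)) = s * e (𝒸 x)` on `S` exists as soon as LIN-X, LIN-𝒪
(H9, value form) and the LATTICE `Φ` (§5) are supplied — k2-g18's H10 row ("TO WRITE, S") discharged modulo its genuine inputs.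
[cite: Washington1997, §13.2, §7.1] [cite: Kato2004Asterisque, Thm. 12.5 (1) (p. 221)] -/
theorem exists_trivialisation (ι : R →+* 𝒪) (𝒸 : H →+ (Fin n → PowerSeries R)) (S : Submodule (PowerSeries 𝒪) H)
    (A : 𝒪 →+* Matrix (Fin n) (Fin n) R) (Φ : 𝒪 ≃+ (Fin n → R)) (hΦA : ∀ a b : 𝒪, Φ (a * b) = (A a).mulVec (Φ b))
    (hΦι : ∀ (c : R) (b : 𝒪), Φ (ι c * b) = c • Φ b)
    (hX : ∀ x ∈ S, 𝒸 ((PowerSeries.X : PowerSeries 𝒪) • x) = (PowerSeries.X : PowerSeries R) • 𝒸 x)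
    (hO : ∀ (a : 𝒪), ∀ x ∈ S, 𝒸 ((PowerSeries.C a : PowerSeries 𝒪) • x) = fun i => ∑ j, (PowerSeries.C (A a i j) : PowerSeries R) * 𝒸 x j) :
    ∃ e : (Fin n → PowerSeries R) ≃+ PowerSeries 𝒪,
      (∀ (r : PowerSeries R) (t : Fin n → PowerSeries R), e (r • t) = PowerSeries.map ι r * e t) ∧
      ∀ (s : PowerSeries 𝒪), ∀ x ∈ S, e (𝒸 (s • x)) = s * e (𝒸 x) :=
  ⟨triv Φ, triv_smul ι Φ hΦι, semilinear_on_submodule 𝒸 S A Φ hΦA hX hO⟩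

/-! ## §4 GLUE to k2-g18 PLAN 1: H10 on `Λ_𝒪 z` + H11 ⟹ the column identity `he` -/

/-- **`he` of k2-g18's `colQuotEquiv` from its two parts (PROVED).** H10 on `S = Λ_𝒪·z` and the ERL value identity H11 `e (𝒸 z) = D * (Lm * u)` give
`e (𝒸 (r • z)) = r * (D * (Lm * u))` for every `r ∈ Λ_𝒪`. [cite: Kato2004Asterisque, Thm. 12.5 (1) (p. 221)] -/
theorem he_of_parts (𝒸 : H →+ (Fin n → PowerSeries R)) (z : H) (e : (Fin n → PowerSeries R) ≃+ PowerSeries 𝒪)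
    (htriv : ∀ (s : PowerSeries 𝒪), ∀ x ∈ Submodule.span (PowerSeries 𝒪) ({z} : Set H), e (𝒸 (s • x)) = s * e (𝒸 x))
    (D Lm u : PowerSeries 𝒪) (hval : e (𝒸 z) = D * (Lm * u)) (r : PowerSeries 𝒪) :
    e (𝒸 (r • z)) = r * (D * (Lm * u)) := by
  rw [htriv r z (Submodule.mem_span_singleton_self z), hval]

/-- **The PRICE node, decomposed (PROVED glue, end to end).** LIN-X + LIN-𝒪 on `Λ_𝒪·z` + LATTICE + H11 (for the produced `e`) ⟹ k2-g18's input
`⟨e, u, hu, he⟩` with `e` `Λ`-semilinear. [cite: Kato2004Asterisque, Thm. 12.5 (1) (p. 221)] [cite: Washington1997, §13.2] -/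
theorem price_of_parts (ι : R →+* 𝒪) (𝒸 : H →+ (Fin n → PowerSeries R)) (z : H)
    (A : 𝒪 →+* Matrix (Fin n) (Fin n) R) (Φ : 𝒪 ≃+ (Fin n → R)) (hΦA : ∀ a b : 𝒪, Φ (a * b) = (A a).mulVec (Φ b))
    (hΦι : ∀ (c : R) (b : 𝒪), Φ (ι c * b) = c • Φ b)
    (hX : ∀ x ∈ Submodule.span (PowerSeries 𝒪) ({z} : Set H),
      𝒸 ((PowerSeries.X : PowerSeries 𝒪) • x) = (PowerSeries.X : PowerSeries R) • 𝒸 x)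
    (hO : ∀ (a : 𝒪), ∀ x ∈ Submodule.span (PowerSeries 𝒪) ({z} : Set H),
      𝒸 ((PowerSeries.C a : PowerSeries 𝒪) • x) = fun i => ∑ j, (PowerSeries.C (A a i j) : PowerSeries R) * 𝒸 x j)
    (D Lm : PowerSeries 𝒪)
    (hERL : ∀ e : (Fin n → PowerSeries R) ≃+ PowerSeries 𝒪,
      (∀ (r : PowerSeries R) (t : Fin n → PowerSeries R), e (r • t) = PowerSeries.map ι r * e t) →
      (∀ (a : 𝒪) (t : Fin n → PowerSeries R), e (fun i => ∑ j, (PowerSeries.C (A a i j) : PowerSeries R) * t j) = (PowerSeries.C a : PowerSeries 𝒪) * e t) →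
      ∃ u : PowerSeries 𝒪, u ≠ 0 ∧ e (𝒸 z) = D * (Lm * u)) :
    ∃ (e : (Fin n → PowerSeries R) ≃+ PowerSeries 𝒪) (u : PowerSeries 𝒪), u ≠ 0 ∧
      (∀ (r : PowerSeries R) (t : Fin n → PowerSeries R), e (r • t) = PowerSeries.map ι r * e t) ∧
      ∀ r : PowerSeries 𝒪, e (𝒸 (r • z)) = r * (D * (Lm * u)) := by
  obtain ⟨u, hu, hval⟩ := hERL (triv Φ) (triv_smul ι Φ hΦι) (triv_matrixSMul Φ A hΦA)
  exact ⟨triv Φ, u, hu, triv_smul ι Φ hΦι,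
    he_of_parts 𝒸 z (triv Φ) (semilinear_on_submodule 𝒸 _ A Φ hΦA hX hO) D Lm u hval⟩

end Semilinear

/-! ## §5 LATTICE (H10 (a)): a torsion-free `𝒪`-structure on `Rⁿ` through `A : 𝒪 →+* Mₙ(R)` is free of rank one when `𝒪` is a PID of `R`-rank `n` -/

section Lattice

variable {R : Type*} [CommRing R] [Nontrivial R] {𝒪 : Type*} [CommRing 𝒪] [IsDomain 𝒪] [IsPrincipalIdealRing 𝒪] {n : ℕ}

/-- The action ring hom `𝒪 →+* End_R(Rⁿ)` of a matrix representation (used only inside proofs, via `Module.compHom`). [cite: Lang1990, Ch. 5 §1] -/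
def actHom (A : 𝒪 →+* Matrix (Fin n) (Fin n) R) : 𝒪 →+* Module.End R (Fin n → R) where
  toFun a := Matrix.toLin' (A a)
  map_one' := by rw [map_one, Matrix.toLin'_one]; rfl
  map_mul' a b := by rw [map_mul, Matrix.toLin'_mul]; rfl
  map_zero' := by rw [map_zero, map_zero]
  map_add' a b := by rw [map_add, map_add]

/-- **LATTICE (H10 (a), PROVED).** Let `ι : R →+* 𝒪` make `𝒪` additively `Rⁿ` (`B`, `hB` — the `OnePairPins` fields `B`/`hB` pattern, no algebra instance),
`𝒪` a PID, and `A : 𝒪 →+* Mₙ(R)` a representation with `A (ι c) = c • 1` and no zero-divisors on vectors. Then `Rⁿ` is a free `𝒪`-module of rank one through `A`: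
there is an additive `Φ : 𝒪 ≃+ Rⁿ` with `Φ (a * b) = A a *ᵥ Φ b` (hence `Φ (ι c * b) = c • Φ b`). Structure theorem over a PID + rank count
`n · rk_𝒪 = n`. At RTT: `R = ℤ₂`, `𝒪 = 𝒪_S`, `n = f`, `A` = §1's transport of the `𝒪`-action on `(K/𝒪)²[2^∞]`-points through `Θ` (faithful on the
`2`-adic Tate module ⟹ torsion-free). [cite: Lang1990, Ch. 5 §1] [cite: Washington1997, §13.2] -/
theorem exists_equivariant_addEquiv (ι : R →+* 𝒪) (hn0 : 0 < n) (B : 𝒪 ≃+ (Fin n → R)) (hB : ∀ (c : R) (b : 𝒪), B (ι c * b) = c • B b)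
    (A : 𝒪 →+* Matrix (Fin n) (Fin n) R) (hAι : ∀ c : R, A (ι c) = c • (1 : Matrix (Fin n) (Fin n) R))
    (htf : ∀ (a : 𝒪) (v : Fin n → R), (A a).mulVec v = 0 → a = 0 ∨ v = 0) :
    ∃ Φ : 𝒪 ≃+ (Fin n → R), (∀ a b : 𝒪, Φ (a * b) = (A a).mulVec (Φ b)) ∧ ∀ (c : R) (b : 𝒪), Φ (ι c * b) = c • Φ b := by
  classical
  -- (0) the second clause follows from the first
  suffices h : ∃ Φ : 𝒪 ≃+ (Fin n → R), ∀ a b : 𝒪, Φ (a * b) = (A a).mulVec (Φ b) by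
    obtain ⟨Φ, hΦ⟩ := h
    exact ⟨Φ, hΦ, fun c b => by rw [hΦ, hAι, Matrix.smul_mulVec, Matrix.one_mulVec]⟩
  -- (1) `R`-algebra structure on `𝒪` through `ι`; `𝒪` is free of rank `n` over `R` through `B`
  letI : Algebra R 𝒪 := ι.toAlgebra
  have hι : ∀ c : R, algebraMap R 𝒪 c = ι c := fun _ => rfl
  let L : 𝒪 ≃ₗ[R] (Fin n → R) :=
    { B with map_smul' := fun c b => by rw [Algebra.smul_def, hι]; exact hB c b }
  haveI : Module.Free R 𝒪 := Module.Free.of_equiv L.symm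
  haveI : Module.Finite R 𝒪 := Module.Finite.equiv L.symm
  have hrk : Module.finrank R 𝒪 = n := by rw [L.finrank_eq, Module.finrank_fin_fun]
  -- (2) the `𝒪`-module structure on `Rⁿ` through `A`
  letI instA : Module 𝒪 (Fin n → R) := Module.compHom (Fin n → R) (actHom A)
  have hsmul : ∀ (a : 𝒪) (v : Fin n → R), a • v = (A a).mulVec v := fun a v => Matrix.toLin'_apply (A a) v
  haveI : IsScalarTower R 𝒪 (Fin n → R) := ⟨fun c a v => by
    rw [hsmul, hsmul, Algebra.smul_def, hι, map_mul, hAι, smul_mul_assoc, one_mul, Matrix.smul_mulVec]⟩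
  haveI : Module.Finite 𝒪 (Fin n → R) := Module.Finite.of_restrictScalars_finite R 𝒪 (Fin n → R)
  haveI : NoZeroSMulDivisors 𝒪 (Fin n → R) := ⟨fun {a v} h => htf a v (by rwa [← hsmul])⟩
  haveI : Module.Free 𝒪 (Fin n → R) := Module.free_of_finite_type_torsion_free'
  -- (3) rank count: `n * rk_𝒪 (Rⁿ) = n`
  have hmul := Module.finrank_mul_finrank R 𝒪 (Fin n → R)
  rw [hrk, Module.finrank_fin_fun] at hmul
  have h1 : Module.finrank 𝒪 (Fin n → R) = 1 := Nat.eq_of_mul_eq_mul_left hn0 (by rw [hmul, mul_one])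
  -- (4) a basis of cardinality one
  let b := Module.finBasisOfFinrankEq 𝒪 (Fin n → R) h1
  let E : (Fin n → R) ≃ₗ[𝒪] 𝒪 := b.equivFun.trans (LinearEquiv.funUnique (Fin 1) 𝒪 𝒪)
  refine ⟨E.symm.toAddEquiv, fun a b' => ?_⟩
  show E.symm (a * b') = (A a).mulVec (E.symm b')
  rw [← smul_eq_mul, LinearEquiv.map_smul, hsmul]

omit [Nontrivial R] [IsDomain 𝒪] [IsPrincipalIdealRing 𝒪] in
/-- **Torsion-freeness is automatic (the `htf` input of `exists_equivariant_addEquiv`).** If every `a ≠ 0` in `𝒪` divides a nonzero CONSTANT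
(`a * a' = ι c`, `c ≠ 0` — the norm: `𝒪_S` is an order over `ℤ₂`) and `R` is a domain, then `A a *ᵥ v = 0 ⟹ a = 0 ∨ v = 0`.
(k2-g19 records the same remark via `Algebra.IsAlgebraic`; this is the instance-free form.) [cite: Lang1990, Ch. 5 §1] -/
theorem htf_of_norm [IsDomain R] (ι : R →+* 𝒪) (A : 𝒪 →+* Matrix (Fin n) (Fin n) R)
    (hAι : ∀ c : R, A (ι c) = c • (1 : Matrix (Fin n) (Fin n) R))
    (hnorm : ∀ a : 𝒪, a ≠ 0 → ∃ (a' : 𝒪) (c : R), c ≠ 0 ∧ a' * a = ι c)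
    (a : 𝒪) (v : Fin n → R) (hv : (A a).mulVec v = 0) : a = 0 ∨ v = 0 := by
  classical
  by_cases ha : a = 0
  · exact Or.inl ha
  · refine Or.inr ?_
    obtain ⟨a', c, hc, h⟩ := hnorm a ha
    have h1 : (A (a' * a)).mulVec v = 0 := by rw [map_mul, ← Matrix.mulVec_mulVec, hv, Matrix.mulVec_zero]
    rw [h, hAι, Matrix.smul_mulVec, Matrix.one_mulVec] at h1
    exact (smul_eq_zero.mp h1).resolve_left hc

end Lattice

/-! ## §6 Rank bookkeeping `n = f` from `2`-torsion counts through `Θ` -/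

section Count

variable {T : Type*} [AddCommGroup T] {M : Type*} [AddCommGroup M] {n : ℕ}

/-- `Θ : M ≃+ Tⁿ` restricts to `M[2] ≃ (T[2])ⁿ`. [cite: Serre1972, Prop. 12] -/
def twoTorsionEquiv (Θ : M ≃+ (Fin n → T)) : {m : M // 2 • m = 0} ≃ (Fin n → {t : T // 2 • t = 0}) where
  toFun m := fun i => ⟨Θ m.1 i, by rw [← Pi.smul_apply, ← map_nsmul, m.2, map_zero, Pi.zero_apply]⟩
  invFun w := ⟨Θ.symm fun i => (w i).1, by
    rw [← map_nsmul]
    have : (2 : ℕ) • (fun i => ((w i).1 : T)) = 0 := funext fun i => by rw [Pi.smul_apply, (w i).2, Pi.zero_apply]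
    rw [this, map_zero]⟩
  left_inv m := by
    apply Subtype.ext
    simp only [AddEquiv.symm_apply_apply]
  right_inv w := by
    funext i
    apply Subtype.ext
    simp only [AddEquiv.apply_symm_apply]

/-- **`n = f` (PROVED).** If `#T[2] = q > 1` and `#M[2] = qᶠ`, an additive `Θ : M ≃+ Tⁿ` forces `n = f` (at RTT: `q = 4`, `M = (K_S/𝒪_S)²`,
`T = W[2^∞]`, so the RSL_g binder `n` IS `f = [𝒪_S : ℤ₂]`). [cite: Serre1972, Prop. 12] -/
theorem n_eq_of_card_two_torsion (Θ : M ≃+ (Fin n → T)) {q f : ℕ} (hq : 1 < q)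
    (hT : Nat.card {t : T // 2 • t = 0} = q) (hM : Nat.card {m : M // 2 • m = 0} = q ^ f) : n = f := by
  haveI : Finite {t : T // 2 • t = 0} := Nat.finite_of_card_ne_zero (by rw [hT]; omega)
  have hcard := Nat.card_congr (twoTorsionEquiv Θ)
  rw [hM, Nat.card_fun, hT, Nat.card_eq_fintype_card, Fintype.card_fin] at hcard
  exact (Nat.pow_right_injective hq hcard).symm

end Count

end Summit.BirchSwinnertonDyer.BirchSwinnertonDyer.Cruxes.ResidualThetaCountLowerPureAtTwo.SideaK3G19

end
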